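import Mathlib
import HarnessLib
import Summits.ValiantsHypothesis.ValiantsHypothesis.Theorems.MonotoneRestorationOrbitRestorationQPAltFixMain
import Summits.ValiantsHypothesis.ValiantsHypothesis.Theorems.MonotoneRestorationOrbitRestorationQPValueDerivation

/-!
# Alternating-fixed vectors RELATIVE to a frozen set: small modules for the pointwise stabiliser of `I` are alt-spanned
(route MonotoneRestoration, crux `OrbitRestorationQP` stmt-ValiantsHypothesis-18293, line `depth-three-rung`, stub A_∞
`stub_sigmaPiSigmaValue`; representation-theoretic infrastructure)

Namespace `Summit.ValiantsHypothesis.ValiantsHypothesis.Theorems.AltFix`.  Definition-free.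

`AltFix.altFix` (`…AltFixMain.lean`) is stated for representations of `Sym (Fin n)`; `AltFix.smallModules_altSpanning`
(`…SmallModulesAltSpanning.lean`) for subspaces of polynomials on the `n × n` matrix stable under the FULL diagonal action.  The
derivative tower needed no more, because derivative spaces of an invariant polynomial are stable under the whole group.  The next
strata of A_∞ (flattening spaces of a matrix-symmetric polynomial along a set `I` of frozen indices: column/cell tensor rank,
read-once products, low flattening rank — items R1/LFR of the repair census) produce small subspaces stable only under the
POINTWISE STABILISER of `I`.  This file transports the two results to that relative setting:

* `altFix_fintype` — `altFix` for representations of `Equiv.Perm α`, `α` any finite type (transport along `Fintype.equivFin`);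
* `smallModules_altSpanning_rel` — **for every `c` there are `k = 3c` and `n₀` such that, for every finite `I ⊆ Fin n` with
  `n₀ ≤ n - |I|`, every finite-dimensional subspace `W` of polynomials on the `n × n` matrix with `finrank W ≤ (n - |I|)^c + c`
  that is stable under the diagonal renamings `ren ρ` of the permutations `ρ` FIXING `I` POINTWISE is contained in the span of
  its members fixed by every even permutation fixing pointwise a set `Y ⊇ I` with `|Y| ≤ |I| + k`.**

Proof of the second: as in the absolute case — pass to the quotient of `W` by the span of the relatively alt-supported members,
make `Perm {x // x ∉ I}` act on it through `Equiv.Perm.ofSubtype`, find an alternating-fixed vector there by `altFix_fintype`,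
and average a lift over the finite group of even permutations fixing `I ∪ Y'`.  Honest label: infrastructure; no stub closed;
VP ≠ VNP untouched. [folklore]
-/

noncomputable section

open scoped Classical

-- `Summit.ValiantsHypothesis.ValiantsHypothesis.…` is the tree's single-conjunct layout (Sub = Summit).
set_option linter.dupNamespace false

namespace Summit.ValiantsHypothesis.ValiantsHypothesis.Theorems

namespace AltFix

open MvPolynomial Equiv Equiv.Perm Module Module.End

/-- **`altFix` on an arbitrary finite type.**  For every `c` there is `n₀` such that every representation of `Equiv.Perm α`
(`α` finite with `n₀ ≤ |α|`) of dimension `≤ |α|^c + c` has a nonzero vector fixed by all even permutations fixing pointwise some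
`≤ 3c` points. [folklore] -/
theorem altFix_fintype (c : ℕ) : ∃ n₀ : ℕ, ∀ (α : Type) [Fintype α] [DecidableEq α], n₀ ≤ Fintype.card α →
    ∀ (V : Type) [AddCommGroup V] [Module ℂ V] [FiniteDimensional ℂ V] [Nontrivial V]
      (ρ : Perm α →* Module.End ℂ V), Module.finrank ℂ V ≤ Fintype.card α ^ c + c →
      ∃ Y : Finset α, Y.card ≤ 3 * c ∧ ∃ v : V, v ≠ 0 ∧
        ∀ g : Perm α, (∀ x ∈ Y, g x = x) → Perm.sign g = 1 → ρ g v = v := by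
  obtain ⟨n₀, hn₀⟩ := altFix c
  refine ⟨n₀, fun α _ _ hα V _ _ _ _ ρ hdim => ?_⟩
  set m := Fintype.card α with hm
  let e : α ≃ Fin m := Fintype.equivFin α
  let ρ' : Perm (Fin m) →* Module.End ℂ V := ρ.comp (e.symm.permCongrHom : Perm (Fin m) ≃* Perm α).toMonoidHom
  have hdim' : Module.finrank ℂ V ≤ m ^ c + c := hdim
  obtain ⟨Y', hY'k, v, hv0, hvfix⟩ := hn₀ m hα V ρ' hdim'
  refine ⟨Y'.map e.symm.toEmbedding, by rw [Finset.card_map]; exact hY'k, v, hv0, fun g hg hs => ?_⟩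
  have hg' : ∀ y ∈ Y', (e.permCongr g) y = y := by
    intro y hy
    have h1 : g (e.symm y) = e.symm y := hg (e.symm y) (Finset.mem_map_of_mem _ hy)
    simp only [Equiv.permCongr_apply, h1, Equiv.apply_symm_apply]
  have hs' : Perm.sign (e.permCongr g) = 1 := by rw [Perm.sign_permCongr]; exact hs
  have h := hvfix (e.permCongr g) hg' hs'
  have hρ' : ρ' (e.permCongr g) = ρ g := by
    show ρ ((e.symm.permCongrHom : Perm (Fin m) ≃* Perm α) (e.permCongr g)) = ρ g
    congr 1
    rw [Equiv.permCongrHom_coe]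
    ext x
    simp only [Equiv.permCongr_apply, Equiv.symm_symm, Equiv.symm_apply_apply]
  rwa [hρ'] at h

variable {n : ℕ}

/-- A permutation fixing `I` pointwise preserves the complement of `I`. [folklore] -/
theorem apply_not_mem_iff {I : Finset (Fin n)} {ρ : Perm (Fin n)} (hρ : ∀ i ∈ I, ρ i = i) (x : Fin n) :
    ρ x ∉ I ↔ x ∉ I := by
  constructor
  · intro h hx; exact h (by rw [hρ x hx]; exact hx)
  · intro h hx
    have h1 : ρ (ρ x) = ρ x := hρ _ hx
    exact h (by rw [← ρ.injective h1]; exact hx)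

/-- A permutation fixing `I` pointwise is `ofSubtype` of its restriction to the complement. [folklore] -/
theorem ofSubtype_subtypePerm_compl {I : Finset (Fin n)} {ρ : Perm (Fin n)} (hρ : ∀ i ∈ I, ρ i = i) :
    Perm.ofSubtype (ρ.subtypePerm (p := fun x => x ∉ I) fun x => apply_not_mem_iff hρ x) = ρ :=
  Perm.ofSubtype_subtypePerm _ fun x hx => fun hxI => hx (hρ x hxI)

/-- **SMALL RELATIVELY-STABLE MODULES ARE RELATIVELY ALT-SPANNED.**  For every `c` there are `k = 3c` and `n₀` such that for
every finite set `I ⊆ Fin n` of frozen indices with `n₀ ≤ n - |I|`, every finite-dimensional subspace `W` of polynomials on the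
`n × n` matrix with `finrank W ≤ (n - |I|)^c + c`, stable under the diagonal renamings `ren ρ` of all `ρ ∈ Sym (Fin n)` fixing `I`
pointwise, is contained in the span of its members fixed by every even permutation fixing pointwise some `Y ⊇ I` with
`|Y| ≤ |I| + k`. [folklore] -/
theorem smallModules_altSpanning_rel (c : ℕ) : ∃ k n₀ : ℕ, ∀ (n : ℕ) (I : Finset (Fin n)), n₀ ≤ n - I.card →
    ∀ W : Submodule ℂ (MvPolynomial (Fin n × Fin n) ℂ), FiniteDimensional ℂ W →
      Module.finrank ℂ W ≤ (n - I.card) ^ c + c →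
      (∀ ρ : Perm (Fin n), (∀ i ∈ I, ρ i = i) → ∀ w ∈ W, ren ρ w ∈ W) →
        W ≤ Submodule.span ℂ {v | v ∈ W ∧ ∃ Y : Finset (Fin n), I ⊆ Y ∧ Y.card ≤ I.card + k ∧
          ∀ ρ : Perm (Fin n), (∀ i ∈ Y, ρ i = i) → Perm.sign ρ = 1 → ren ρ v = v} := by
  obtain ⟨n₀, hn₀⟩ := altFix_fintype c
  refine ⟨3 * c, n₀, fun n I hnI W hWfd hdim hstab => ?_⟩
  haveI := hWfd
  set A : Set (MvPolynomial (Fin n × Fin n) ℂ) := {v | v ∈ W ∧ ∃ Y : Finset (Fin n), I ⊆ Y ∧ Y.card ≤ I.card + 3 * c ∧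
    ∀ ρ : Perm (Fin n), (∀ i ∈ Y, ρ i = i) → Perm.sign ρ = 1 → ren ρ v = v} with hA
  set F := Submodule.span ℂ A with hF
  by_contra hWF
  -- `A` (hence `F`) is stable under the renamings fixing `I`
  have hAst : ∀ ρ : Perm (Fin n), (∀ i ∈ I, ρ i = i) → ∀ v ∈ A, ren ρ v ∈ A := by
    rintro ρ hρ v ⟨hvW, Y, hIY, hYk, hY⟩
    refine ⟨hstab ρ hρ v hvW, Y.image ρ, fun i hi => ?_, Finset.card_image_le.trans hYk, fun ρ' hρ' hs' => ?_⟩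
    · rw [← hρ i hi]; exact Finset.mem_image_of_mem ρ (hIY hi)
    have hconj : ∀ i ∈ Y, (ρ⁻¹ * ρ' * ρ) i = i := by
      intro i hi
      have := hρ' (ρ i) (Finset.mem_image_of_mem ρ hi)
      rw [Perm.mul_apply, Perm.mul_apply, this]
      simp
    have hsconj : Perm.sign (ρ⁻¹ * ρ' * ρ) = 1 := by simp [hs']
    calc ren ρ' (ren ρ v) = ren ρ (ren (ρ⁻¹ * ρ' * ρ) v) := by
          rw [← ren_mul, ← ren_mul]; congr 1; group
      _ = ren ρ v := by rw [hY _ hconj hsconj]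
  have hFst : ∀ ρ : Perm (Fin n), (∀ i ∈ I, ρ i = i) → ∀ v ∈ F, ren ρ v ∈ F := by
    intro ρ hρ v hv
    have h1 : F.map (ren ρ).toLinearMap ≤ F := by
      rw [hF, Submodule.map_span, Submodule.span_le]
      rintro _ ⟨u, hu, rfl⟩
      exact Submodule.subset_span (hAst ρ hρ u hu)
    exact h1 ⟨v, hv, rfl⟩
  -- the quotient of `W` by `F ∩ W`
  let F' : Submodule ℂ W := F.comap W.subtype
  have hF'top : F' ≠ ⊤ := by
    intro h
    apply hWF
    intro w hw
    have : (⟨w, hw⟩ : W) ∈ F' := by rw [h]; trivial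
    exact this
  -- the permutations of the complement of `I`, acting through `ofSubtype`
  let ι : Perm {x : Fin n // x ∉ I} →* Perm (Fin n) := Perm.ofSubtype
  have hιfix : ∀ (g : Perm {x : Fin n // x ∉ I}) (i : Fin n), i ∈ I → ι g i = i :=
    fun g i hi => Perm.ofSubtype_apply_of_not_mem g (show ¬ (i ∉ I) from fun h => h hi)
  let renW : Perm {x : Fin n // x ∉ I} → (W →ₗ[ℂ] W) := fun g =>
    (ren (ι g)).toLinearMap.restrict (p := W) (q := W) fun w hw => hstab (ι g) (hιfix g) w hw
  have hrenW : ∀ g (w : W), ((renW g w : W) : MvPolynomial (Fin n × Fin n) ℂ) = ren (ι g) (w : _) :=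
    fun g w => rfl
  have hF'st : ∀ g, F' ≤ F'.comap (renW g) := by
    intro g w hw
    show ((renW g w : W) : MvPolynomial (Fin n × Fin n) ℂ) ∈ F
    rw [hrenW]; exact hFst (ι g) (hιfix g) _ hw
  let actQ : Perm {x : Fin n // x ∉ I} → Module.End ℂ (W ⧸ F') := fun g => F'.mapQ F' (renW g) (hF'st g)
  have hactQ : ∀ g (w : W), actQ g (Submodule.Quotient.mk w) = Submodule.Quotient.mk (renW g w) :=
    fun g w => rfl
  have hrenW1 : ∀ w : W, renW 1 w = w := fun w => Subtype.ext (by rw [hrenW, map_one, ren_one])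
  have hrenWmul : ∀ g h (w : W), renW (g * h) w = renW g (renW h w) := fun g h w =>
    Subtype.ext (by rw [hrenW, hrenW, hrenW, map_mul, ren_mul])
  let ρQ : Perm {x : Fin n // x ∉ I} →* Module.End ℂ (W ⧸ F') :=
    { toFun := actQ
      map_one' := by
        refine Submodule.linearMap_qext _ (LinearMap.ext fun w => ?_)
        simp only [LinearMap.comp_apply, Submodule.mkQ_apply, Module.End.one_apply, hactQ, hrenW1]
      map_mul' := fun g h => by
        refine Submodule.linearMap_qext _ (LinearMap.ext fun w => ?_)
        simp only [LinearMap.comp_apply, Submodule.mkQ_apply, Module.End.mul_apply, hactQ, hrenWmul] }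
  haveI : Nontrivial (W ⧸ F') := Submodule.Quotient.nontrivial_iff.mpr hF'top
  have hcard : Fintype.card {x : Fin n // x ∉ I} = n - I.card := by
    rw [Fintype.card_subtype_compl, Fintype.card_coe, Fintype.card_fin]
  have hdimQ : Module.finrank ℂ (W ⧸ F') ≤ Fintype.card {x : Fin n // x ∉ I} ^ c + c := by
    rw [hcard]; exact (Submodule.finrank_quotient_le F').trans hdim
  obtain ⟨Y', hY'k, q, hq0, hqfix⟩ := hn₀ {x : Fin n // x ∉ I} (by rw [hcard]; exact hnI) (W ⧸ F') ρQ hdimQ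
  obtain ⟨w, rfl⟩ := Submodule.Quotient.mk_surjective F' q
  have hwF : (w : MvPolynomial (Fin n × Fin n) ℂ) ∉ F := fun h =>
    hq0 ((Submodule.Quotient.mk_eq_zero F').mpr h)
  -- the frozen set `Y = I ∪ Y'`
  set Y : Finset (Fin n) := I ∪ Y'.map (Function.Embedding.subtype _) with hYdef
  have hIY : I ⊆ Y := Finset.subset_union_left
  have hYcard : Y.card ≤ I.card + 3 * c :=
    (Finset.card_union_le _ _).trans (by rw [Finset.card_map]; exact Nat.add_le_add_left hY'k _)
  have hY'Y : ∀ y ∈ Y', (y : Fin n) ∈ Y := fun y hy =>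
    Finset.mem_union_right _ (Finset.mem_map.mpr ⟨y, hy, rfl⟩)
  -- the even permutations fixing `Y` pointwise, as a finset
  set G := (Finset.univ : Finset (Perm (Fin n))).filter fun ρ =>
    (∀ i ∈ Y, ρ i = i) ∧ Perm.sign ρ = 1 with hG
  have hGmem : ∀ ρ, ρ ∈ G ↔ (∀ i ∈ Y, ρ i = i) ∧ Perm.sign ρ = 1 := fun ρ => by simp [hG]
  have h1G : (1 : Perm (Fin n)) ∈ G := (hGmem 1).mpr ⟨fun _ _ => rfl, Perm.sign_one⟩
  have hGmul : ∀ ρ' ∈ G, ∀ ρ, ρ ∈ G ↔ ρ' * ρ ∈ G := by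
    intro ρ' hρ' ρ
    obtain ⟨h1, h2⟩ := (hGmem ρ').mp hρ'
    rw [hGmem, hGmem]
    constructor
    · rintro ⟨h3, h4⟩
      exact ⟨fun i hi => by rw [Perm.mul_apply, h3 i hi, h1 i hi], by rw [Perm.sign_mul, h2, h4, one_mul]⟩
    · rintro ⟨h3, h4⟩
      refine ⟨fun i hi => ?_, ?_⟩
      · have := h3 i hi
        rw [Perm.mul_apply] at this
        exact ρ'.injective (this.trans (h1 i hi).symm)
      · rw [Perm.sign_mul, h2, one_mul] at h4; exact h4
  -- every `ρ ∈ G` moves `w` inside `F`: it is `ofSubtype` of an even permutation of the complement fixing `Y'`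
  have hmove : ∀ ρ ∈ G, ren ρ (w : MvPolynomial (Fin n × Fin n) ℂ) - w ∈ F := by
    intro ρ hρ
    obtain ⟨h1, h2⟩ := (hGmem ρ).mp hρ
    have hρI : ∀ i ∈ I, ρ i = i := fun i hi => h1 i (hIY hi)
    set g : Perm {x : Fin n // x ∉ I} := ρ.subtypePerm (p := fun x => x ∉ I) fun x => apply_not_mem_iff hρI x
      with hg
    have hιg : ι g = ρ := ofSubtype_subtypePerm_compl hρI
    have hgY : ∀ y ∈ Y', g y = y := fun y hy => Subtype.ext (h1 _ (hY'Y y hy))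
    have hgs : Perm.sign g = 1 := by
      have := Perm.sign_ofSubtype g
      rw [show Perm.ofSubtype g = ρ from hιg, h2] at this
      exact this.symm
    have h3 := hqfix g hgY hgs
    change actQ g (Submodule.Quotient.mk w) = Submodule.Quotient.mk w at h3
    rw [hactQ, Submodule.Quotient.eq] at h3
    have h4 : ((renW g w : W) : MvPolynomial (Fin n × Fin n) ℂ) - w ∈ F := h3
    rwa [hrenW, hιg] at h4
  -- the average is alt-supported on `Y ⊇ I`, hence in `A ⊆ F`
  set v' := ∑ ρ ∈ G, ren ρ (w : MvPolynomial (Fin n × Fin n) ℂ) with hv'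
  have hv'A : v' ∈ A := by
    refine ⟨Submodule.sum_mem _ fun ρ hρ => hstab ρ (fun i hi => ((hGmem ρ).mp hρ).1 i (hIY hi)) _ w.2, Y, hIY, hYcard,
      fun ρ' hρ' hs' => ?_⟩
    have hρ'G : ρ' ∈ G := (hGmem ρ').mpr ⟨hρ', hs'⟩
    rw [hv', map_sum]
    simp_rw [← ren_mul]
    exact Finset.sum_equiv (Equiv.mulLeft ρ') (fun ρ => by
      simpa only [Equiv.coe_mulLeft] using hGmul ρ' hρ'G ρ) (fun ρ _ => rfl)
  have hv'F : v' ∈ F := Submodule.subset_span hv'A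
  -- so `|G| • w ∈ F`, and `w ∈ F`: contradiction
  have hsum : v' - ∑ ρ ∈ G, (ren ρ (w : MvPolynomial (Fin n × Fin n) ℂ) - w) =
      (G.card : ℂ) • (w : MvPolynomial (Fin n × Fin n) ℂ) := by
    rw [hv', Finset.sum_sub_distrib, Finset.sum_const, sub_sub_cancel, Nat.cast_smul_eq_nsmul]
  have hGw : (G.card : ℂ) • (w : MvPolynomial (Fin n × Fin n) ℂ) ∈ F := by
    rw [← hsum]
    exact Submodule.sub_mem _ hv'F (Submodule.sum_mem _ fun ρ hρ => hmove ρ hρ)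
  have hGpos : (G.card : ℂ) ≠ 0 := by
    have : 0 < G.card := Finset.card_pos.mpr ⟨1, h1G⟩
    exact_mod_cast this.ne'
  apply hwF
  have := F.smul_mem ((G.card : ℂ)⁻¹) hGw
  rwa [smul_smul, inv_mul_cancel₀ hGpos, one_smul] at this

/-- **The relative lemma with the absolute dimension bound.**  If `2|I| ≤ n` and `2^c ≤ n - |I|` then
`n^c + c ≤ (n - |I|)^(c+1) + (c+1)`, so subspaces of dimension `≤ n^c + c` qualify for `smallModules_altSpanning_rel (c+1)`.
[folklore] -/
theorem pbound_le_compl_pbound {n c : ℕ} {I : Finset (Fin n)} (hI : 2 * I.card ≤ n) (hn : 2 ^ c ≤ n - I.card) :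
    n ^ c + c ≤ (n - I.card) ^ (c + 1) + (c + 1) := by
  set m := n - I.card with hm
  have hnm : n ≤ 2 * m := by omega
  have h1 : n ^ c ≤ (2 * m) ^ c := Nat.pow_le_pow_left hnm c
  have h2 : (2 * m) ^ c = 2 ^ c * m ^ c := by rw [mul_pow]
  have h3 : 2 ^ c * m ^ c ≤ m * m ^ c := Nat.mul_le_mul_right _ hn
  have h4 : m * m ^ c = m ^ (c + 1) := by ring
  omega

end AltFix

end Summit.ValiantsHypothesis.ValiantsHypothesis.Theorems

end
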